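import Literature.AlgebraicGeometry.Frobenioids.ModelFrobenioid
import HarnessLib

/-!
# Frobenioids I, Theorem 5.2 (i): in a model Frobenioid with torsion units, the Frobenius lift is not a monomorphism

Mochizuki, *The geometry of Frobenioids I: the general theory*, Kyushu J. Math. **62** (2008)
293–400, §5, Theorem 5.2 (i), kurims text p. 100 [cite: MochizukiFrdI2008, Thm. 5.2]: in the
model Frobenioid attached to `(Φ, B, Div_B)` the composite of
`φ = (deg_Fr(φ), Base(φ), Div(φ), u_φ)` and `ψ` has unit component
`B(Base(φ))(u_ψ) + deg_Fr(ψ) · u_φ`.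

CONSEQUENCE recorded here (kernel-checked evidence for the cell's proof-route finding PR-1 on
[FrdI] Prop. 1.14 (iii) / Thm. 3.4 (ii); ours, an immediate computation from the printed composite
law, not a statement of the paper): for an object `X = (A, α)` and the morphism
`ψ = (p, id_A, 0, 0) : (A, α) → (A, p · α)` — the base-identity "Frobenius lift" of degree `p` — and
any `u ∈ B(A)` with `p · u = 0`, `Div_B(u) = 0`, the base-identity endomorphism `(1, id_A, 0, u)` of
`X` satisfies `ψ ∘ (1, id_A, 0, u) = ψ`. Hence if `B(A)` has a nontrivial `p`-torsion element in
`Ker(Div_B)` (e.g. `-1` among the units of a number field, `p = 2`), then `ψ` is NOT a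
monomorphism, so not an FSM-, let alone FSMI-morphism (§0 p. 17): the hypothesis "prime-Frobenius
morphisms are FSMI-morphisms" under which the printed argument for Prop. 1.14 (iii) "⟸" goes
through (`IrreducibleMorphismsChainsConverse.lean`) fails in such model Frobenioids.
-/

namespace Literature.AlgebraicGeometry.Frobenioids

open CategoryTheory Opposite

universe w v u

namespace ModelFrobenioid

variable {D : Type u} [Category.{v} D] {Φ B : Dᵒᵖ ⥤ CommMonCat.{w}} {DivB : B ⟶ monoidGp Φ}

/-- In the model Frobenioid of `(Φ, B, Div_B)` (Thm. 5.2 (i)): if `u ∈ B(A)` is a nontrivial element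
with `p · u = 0` and `Div_B(u) = 0`, then the degree-`p` base-identity morphism
`ψ = (p, id_A, 0, 0) : (A, α) → (A, p · α)` is not a monomorphism — it coequalises `id` and the unit
endomorphism `(1, id_A, 0, u)`, by the composite law `u_{ψ ∘ φ} = B(Base φ)(u_ψ) + deg_Fr(ψ) · u_φ`.
[cite: MochizukiFrdI2008, Thm. 5.2(i) p.100] -/
theorem exists_degFr_not_mono_of_torsion_unit (X : ModelFrobenioid Φ B DivB) (p : ℕ+)
    (u : B.obj (op X.base)) (hu : u ≠ 1) (hup : u ^ (p : ℕ) = 1)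
    (hdu : divB Φ B DivB (op X.base) u = 1) :
    ∃ ψ : X ⟶ (⟨X.base, X.cls ^ (p : ℕ)⟩ : ModelFrobenioid Φ B DivB),
      degFr ψ = p ∧ baseMap ψ = 𝟙 X.base ∧ div ψ = 1 ∧ unit ψ = 1 ∧ ¬ Mono ψ := by
  let ψ : X ⟶ (⟨X.base, X.cls ^ (p : ℕ)⟩ : ModelFrobenioid Φ B DivB) :=
    { degFr := p, base := 𝟙 _, div := 1, unit := 1,
      rel := by rw [map_one, mul_one, map_one, mul_one, pullGp_id] }
  -- the unit endomorphism `(1, id, 0, u)` of `X`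
  let φ : X ⟶ X :=
    { degFr := 1, base := 𝟙 _, div := 1, unit := u,
      rel := by rw [PNat.one_coe, pow_one, map_one, mul_one, hdu, mul_one, pullGp_id] }
  have hcomp : φ ≫ ψ = 𝟙 X ≫ ψ := by
    refine hom_ext rfl rfl rfl ?_
    show (B.map (𝟙 X.base).op).hom (1 : B.obj (op X.base)) * u ^ (p : ℕ) =
      (B.map (𝟙 X.base).op).hom (1 : B.obj (op X.base)) * 1 ^ (p : ℕ)
    rw [hup, one_pow]
  refine ⟨ψ, rfl, rfl, rfl, rfl, fun hmono => hu ?_⟩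
  have h1 : φ = 𝟙 X := (cancel_mono ψ).mp hcomp
  exact congrArg unit h1

end ModelFrobenioid

end Literature.AlgebraicGeometry.Frobenioids
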